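import Summits.SmoothPoincare4.SmoothPoincare4.Theorems.EntropyRungChangGurskyYangStubSmoothRoundLimitAux6
import HarnessLib

/-!
# Logarithmic a priori bounds for the Christoffel symbols of a Type-I Ricci flow in a chart, II
(helper file 7 for stub `stub_smoothRoundLimit`, line `margerin-cone-hamilton-rails`, crux
`EntropyRung.ChangGurskyYang`, item stmt-SmoothPoincare4-10834)

Pure coordinate calculus (`MetricCoord`): a smooth family of metric components `G_t` on `V`
solving the coordinate Ricci flow `∂ₜG = −2 Ric(G)` on `[t₀, T)`, with, on a compact `K ⊆ V`,
the SCALED bounds `|g^{ac}| ≤ C_g/(T−t)` (the inverse of `G/(T−t)` is bounded) and bounded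
components of `∇Ric`, `∇²Ric` (scale invariant; from the scaled Shi bounds). Then the Christoffel
symbols and their first coordinate derivatives grow at most LOGARITHMICALLY as `t ↑ T`:

* `abs_le_of_deriv_boundary` — comparison with a boundary function: `|f'| ≤ B'` on `[t₁, T)` gives
  `|f(t)| ≤ |f(t₁)| + B(t) − B(t₁)`;
* `abs_chrCoef_le_log` — `|Γ(y, t)| ≤ A₀ (1 + log((T−t₀)/(T−t)))` on `K × [t₀, T)`: by Topping's
  Prop. 2.3.1, `∂ₜΓ = −g⁻¹ * ∇Ric = O((T−t)⁻¹)`, integrated in time;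
* `abs_pd_chrCoef_le_log_sq` — `|∂Γ(y, t)| ≤ A₁ (1 + log((T−t₀)/(T−t)))²`: differentiate
  `∂ₜΓ` in space (`∂g⁻¹ = −g⁻¹Γ − Γg⁻¹`, `∂(∇Ric) = ∇²Ric + Γ∇Ric`), so that
  `∂ₜ∂Γ = O((1 + log)(T−t)⁻¹)`, and integrate again.

These crude bounds are the lower-order input of the interpolation giving the decay of the
covariant Ricci derivatives of the scaled flow (Hamilton 1982, §17: `∇ᵏRic → 0` for the
normalised flow), which in turn makes `∂ₜΓ` integrable (ibid., §14, Lemma 14.2 ff.).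

## References

* R. S. Hamilton, *Three-manifolds with positive Ricci curvature*, J. Differential Geom. 17
  (1982) 255–306, §14, Lemma 14.2 ff.; §17, Thm. 17.6. [Hamilton1982]
* P. Topping, *Lectures on the Ricci flow*, LMS Lecture Note Series 325, CUP 2006, Prop. 2.3.1;
  §5.3, proof of Thm. 5.3.1, pp. 47–48. [Topping2006]
-/

noncomputable section

-- every `Summit.SmoothPoincare4.SmoothPoincare4.…` name repeats the summit = sub-problem segment (D-0017 layout)
set_option linter.dupNamespace false

-- operator spaces of bilinear forms over the model space
set_option maxSynthPendingDepth 3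

open Set Function Filter Real Module Metric
open scoped Topology ContDiff

namespace Summit.SmoothPoincare4.SmoothPoincare4.Theorems.MargerinRails

open Literature.Geometry.Lorentzian Literature.Geometry.Lorentzian.MetricCoord

universe u

/-! ### Logarithmic bounds for `∂Γ` along the coordinate Ricci flow -/

section LogBounds

variable {E : Type u} [NormedAddCommGroup E] [NormedSpace ℝ E] [FiniteDimensional ℝ E]
  [CompleteSpace E] {ι : Type*} [Fintype ι] (b : Basis ι ℝ E)
  {G : ℝ → E → E →L[ℝ] E →L[ℝ] ℝ} {V K : Set E} {t₀ T : ℝ}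
  (hG : IsMetricFamilyOn G (Ico t₀ T) V)
  (hfl : ∀ s ∈ Ico t₀ T, ∀ y ∈ V, tDeriv G (Ico t₀ T) s y = (-2 : ℝ) • ricAt (G s) y)
  (hK : IsCompact K) (hKV : K ⊆ V) (ht₀ : t₀ < T)
  {Cg : ℝ} (hginv : ∀ t ∈ Ico t₀ T, ∀ y ∈ K, ∀ a c, |ginv (G t) b y a c| ≤ Cg / (T - t))
  {C₁ : ℝ} (hR1 : ∀ t ∈ Ico t₀ T, ∀ y ∈ K, ∀ J : Fin 1 ⊕ Fin 2 → ι,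
    |tcovIter (G t) b 1 (ric2 (G t) b) y J| ≤ C₁)

/-- **The spatial derivative of `∂ₜΓ`**: at a point of `V` where `|g^{ac}| ≤ g₀`, `|Γ| ≤ L`,
`|(∇Ric)_J| ≤ C₁` and `|(∇²Ric)_J| ≤ C₂`, the derivative in the direction `b_p` of Topping's
expression `−Σ_l g^{ml}((∇_jRic)_{il} + (∇_iRic)_{jl} − (∇_lRic)_{ji})` is bounded by
`n g₀ (3 C₂ + 15 n C₁ L)` (`∂g⁻¹ = −g⁻¹Γ − Γg⁻¹`, `∂(∇Ric) = ∇²Ric + Γ ⋆ ∇Ric`).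
[cite: Topping2006, Prop. 2.3.1] [cite: ONeill1983, Ch. 3, p. 86] -/
theorem abs_fderiv_chrDot_le {Gs : E → E →L[ℝ] E →L[ℝ] ℝ} (hGs : IsMetricOn Gs V) {y : E} (hy : y ∈ V)
    {g₀ L C₁' C₂' : ℝ} (hg₀ : ∀ a c, |ginv Gs b y a c| ≤ g₀) (hL : ∀ j i m, |chrCoef Gs b y j i m| ≤ L)
    (h1 : ∀ J : Fin 1 ⊕ Fin 2 → ι, |tcovIter Gs b 1 (ric2 Gs b) y J| ≤ C₁')
    (h2 : ∀ J : Fin 2 ⊕ Fin 2 → ι, |tcovIter Gs b 2 (ric2 Gs b) y J| ≤ C₂') (p j i m : ι) :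
    |fderiv ℝ (fun z ↦ -∑ d, ginv Gs b z m d * (tcov Gs b (ric2 Gs b) z (ocons j (pair i d))
        + tcov Gs b (ric2 Gs b) z (ocons i (pair j d))
        - tcov Gs b (ric2 Gs b) z (ocons d (pair j i)))) y (b p)| ≤
      Fintype.card ι * g₀ * (3 * C₂' + 15 * Fintype.card ι * C₁' * L) := by
  have hV : IsOpen V := hGs.isOpen
  have hn : V ∈ 𝓝 y := hV.mem_nhds hy
  -- nonnegativity of the constants
  rcases isEmpty_or_nonempty ι with hι | hι
  · simp [Finset.univ_eq_empty]
  obtain ⟨i₀⟩ := hι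
  have hg₀nn : 0 ≤ g₀ := (abs_nonneg _).trans (hg₀ i₀ i₀)
  have hLnn : 0 ≤ L := (abs_nonneg _).trans (hL i₀ i₀ i₀)
  have hC₁nn : 0 ≤ C₁' := (abs_nonneg _).trans (h1 fun _ ↦ i₀)
  have hC₂nn : 0 ≤ C₂' := (abs_nonneg _).trans (h2 fun _ ↦ i₀)
  -- the factors and their derivatives
  set gf : ι → E → ℝ := fun d z ↦ ginv Gs b z m d with hgf
  set A : (Option (Fin 2) → ι) → E → ℝ := fun J z ↦ tcov Gs b (ric2 Gs b) z J with hA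
  have hgd : ∀ d, DifferentiableAt ℝ (gf d) y := fun d ↦
    (((hGs.contDiffOn_ginv b m d).differentiableOn (by simp)) y hy).differentiableAt hn
  have hT : TSmoothOn (tcov Gs b (ric2 Gs b)) V := hGs.tsmoothOn_tcov (hGs.tsmoothOn_ric2 (b := b))
  have hAd : ∀ J, DifferentiableAt ℝ (A J) y := fun J ↦
    (((hT J).differentiableOn (by simp)) y hy).differentiableAt hn
  set W : ι → E → ℝ := fun d z ↦ A (ocons j (pair i d)) z + A (ocons i (pair j d)) z
    - A (ocons d (pair j i)) z with hW
  have hWd : ∀ d, DifferentiableAt ℝ (W d) y := fun d ↦ ((hAd _).add (hAd _)).sub (hAd _)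
  -- the derivative
  have hderiv : HasFDerivAt (fun z ↦ -∑ d, gf d z * W d z)
      (-∑ d, (gf d y • fderiv ℝ (W d) y + W d y • fderiv ℝ (gf d) y)) y :=
    (HasFDerivAt.fun_sum fun d _ ↦ (hgd d).hasFDerivAt.fun_mul (hWd d).hasFDerivAt).neg
  have hfun : (fun z ↦ -∑ d, ginv Gs b z m d * (tcov Gs b (ric2 Gs b) z (ocons j (pair i d))
        + tcov Gs b (ric2 Gs b) z (ocons i (pair j d))
        - tcov Gs b (ric2 Gs b) z (ocons d (pair j i)))) = fun z ↦ -∑ d, gf d z * W d z := rfl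
  rw [hfun, hderiv.fderiv]
  simp only [neg_apply, FunLike.coe_sum, Finset.sum_apply, add_apply, FunLike.coe_smul,
    Pi.smul_apply, smul_eq_mul, abs_neg]
  -- bounds of the pieces
  have hgb : ∀ d, |gf d y| ≤ g₀ := fun d ↦ hg₀ m d
  have hAb : ∀ J, |A J y| ≤ C₁' := fun J ↦ by
    simp only [hA]; rw [tcov_eq_tcovIter_one b]; exact h1 _
  have hWb : ∀ d, |W d y| ≤ 3 * C₁' := fun d ↦ by
    simp only [hW]
    calc _ ≤ |A (ocons j (pair i d)) y + A (ocons i (pair j d)) y| + |A (ocons d (pair j i)) y| := abs_sub _ _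
      _ ≤ (C₁' + C₁') + C₁' := add_le_add ((abs_add_le _ _).trans (add_le_add (hAb _) (hAb _))) (hAb _)
      _ = 3 * C₁' := by ring
  have hgd' : ∀ d, |fderiv ℝ (gf d) y (b p)| ≤ 2 * Fintype.card ι * g₀ * L := by
    intro d
    simp only [hgf]
    rw [hGs.fderiv_ginv_eq_chrCoef b hy m d p]
    calc _ ≤ |-(∑ c, ginv Gs b y m c * chrCoef Gs b y p c d)| + |∑ e, chrCoef Gs b y p e m * ginv Gs b y e d| :=
          abs_sub _ _
      _ ≤ (∑ _c : ι, g₀ * L) + ∑ _e : ι, L * g₀ := by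
          rw [abs_neg]
          refine add_le_add ((Finset.abs_sum_le_sum_abs _ _).trans (Finset.sum_le_sum fun c _ ↦ ?_))
            ((Finset.abs_sum_le_sum_abs _ _).trans (Finset.sum_le_sum fun e _ ↦ ?_))
          · rw [abs_mul]; exact mul_le_mul (hgb c) (hL _ _ _) (abs_nonneg _) hg₀nn
          · rw [abs_mul]; exact mul_le_mul (hL _ _ _) (hg₀ e d) (abs_nonneg _) hLnn
      _ = 2 * Fintype.card ι * g₀ * L := by
          rw [Finset.sum_const, Finset.sum_const, Finset.card_univ, nsmul_eq_mul, nsmul_eq_mul]; ring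
  have hAd' : ∀ J, |fderiv ℝ (A J) y (b p)| ≤ C₂' + 3 * Fintype.card ι * (L * C₁') := by
    intro J
    have hfunJ : A J = fun z ↦ tcovIter Gs b 1 (ric2 Gs b) z (J ∘ relabelOne (Fin 2)) := by
      funext z; simp only [hA]; rw [tcov_eq_tcovIter_one b]
    rw [hfunJ, fderiv_tcovIter_apply]
    calc _ ≤ |tcovIter Gs b (1 + 1) (ric2 Gs b) y (ocons p (J ∘ relabelOne (Fin 2)) ∘ ⇑(shiftEquiv 1 (Fin 2)).symm)|
          + |∑ a, ∑ m', chrCoef Gs b y p ((J ∘ relabelOne (Fin 2)) a) m' *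
              tcovIter Gs b 1 (ric2 Gs b) y (update (J ∘ relabelOne (Fin 2)) a m')| := abs_add_le _ _
      _ ≤ C₂' + ∑ _a : Fin 1 ⊕ Fin 2, ∑ _m' : ι, L * C₁' := by
          refine add_le_add (h2 _) ((Finset.abs_sum_le_sum_abs _ _).trans (Finset.sum_le_sum fun a _ ↦
            (Finset.abs_sum_le_sum_abs _ _).trans (Finset.sum_le_sum fun m' _ ↦ ?_)))
          rw [abs_mul]; exact mul_le_mul (hL _ _ _) (h1 _) (abs_nonneg _) hLnn
      _ = C₂' + 3 * Fintype.card ι * (L * C₁') := by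
          rw [Finset.sum_const, Finset.card_univ, nsmul_eq_mul]
          simp only [Finset.sum_const, Finset.card_univ, nsmul_eq_mul, Fintype.card_sum, Fintype.card_fin]
          push_cast; ring
  have hWd' : ∀ d, |fderiv ℝ (W d) y (b p)| ≤ 3 * (C₂' + 3 * Fintype.card ι * (L * C₁')) := by
    intro d
    have hWderiv : HasFDerivAt (W d) (fderiv ℝ (A (ocons j (pair i d))) y + fderiv ℝ (A (ocons i (pair j d))) y
        - fderiv ℝ (A (ocons d (pair j i))) y) y :=
      ((hAd _).hasFDerivAt.add (hAd _).hasFDerivAt).sub (hAd _).hasFDerivAt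
    rw [hWderiv.fderiv]
    simp only [sub_apply, add_apply]
    calc _ ≤ |fderiv ℝ (A (ocons j (pair i d))) y (b p) + fderiv ℝ (A (ocons i (pair j d))) y (b p)|
          + |fderiv ℝ (A (ocons d (pair j i))) y (b p)| := abs_sub _ _
      _ ≤ _ := by
          have e1 := hAd' (ocons j (pair i d)); have e2 := hAd' (ocons i (pair j d))
          have e3 := hAd' (ocons d (pair j i))
          have e4 := abs_add_le (fderiv ℝ (A (ocons j (pair i d))) y (b p)) (fderiv ℝ (A (ocons i (pair j d))) y (b p))
          linarith
  -- assemble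
  calc |∑ d, (gf d y * fderiv ℝ (W d) y (b p) + W d y * fderiv ℝ (gf d) y (b p))|
      ≤ ∑ d, |gf d y * fderiv ℝ (W d) y (b p) + W d y * fderiv ℝ (gf d) y (b p)| := Finset.abs_sum_le_sum_abs _ _
    _ ≤ ∑ _d : ι, (g₀ * (3 * (C₂' + 3 * Fintype.card ι * (L * C₁'))) + 3 * C₁' * (2 * Fintype.card ι * g₀ * L)) := by
        refine Finset.sum_le_sum fun d _ ↦ (abs_add_le _ _).trans (add_le_add ?_ ?_)
        · rw [abs_mul]; exact mul_le_mul (hgb d) (hWd' d) (abs_nonneg _) hg₀nn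
        · rw [abs_mul]; exact mul_le_mul (hWb d) (hgd' d) (abs_nonneg _) (by positivity)
    _ = Fintype.card ι * g₀ * (3 * C₂' + 15 * Fintype.card ι * C₁' * L) := by
        rw [Finset.sum_const, Finset.card_univ, nsmul_eq_mul]; ring

include hG hfl hK hKV ht₀ hginv hR1 in
/-- **Squared-logarithmic growth of the first coordinate derivatives of the Christoffel symbols**:
with moreover `|(∇²Ric)_J| ≤ C₂` on `K × [t₀, T)`, one has
`|∂_p Γ^m_{ji}(y, t)| ≤ A₁ (1 + log((T−t₀)/(T−t)))²` there. Proof: `∂ₜ` and `∂_p` commute on the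
jointly smooth `Γ` (`derivWithin_pdIter_comm`), the spatial derivative of Topping's formula for
`∂ₜΓ` is `O((1 + log)/(T−t))` by `abs_fderiv_chrDot_le` and `abs_chrCoef_le_log`, and the
comparison lemma integrates it from the compact slice `t = t₀`.
[cite: Hamilton1982, §14, Lemma 14.2 ff.] [cite: Topping2006, Prop. 2.3.1] -/
theorem abs_pd_chrCoef_le_log_sq {C₂ : ℝ} (hR2 : ∀ t ∈ Ico t₀ T, ∀ y ∈ K, ∀ J : Fin 2 ⊕ Fin 2 → ι,
      |tcovIter (G t) b 2 (ric2 (G t) b) y J| ≤ C₂) :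
    ∃ A₁ : ℝ, 0 ≤ A₁ ∧ ∀ t ∈ Ico t₀ T, ∀ y ∈ K, ∀ p j i m : ι,
      |pd b p (fun y' ↦ chrCoef (G t) b y' j i m) y| ≤ A₁ * (1 + Real.log ((T - t₀) / (T - t))) ^ 2 := by
  have hV : IsOpen V := hG.isOpen ⟨le_rfl, ht₀⟩
  have ht₀' : t₀ ∈ Ico t₀ T := ⟨le_rfl, ht₀⟩
  have hS : UniqueDiffOn ℝ (Ico t₀ T) := uniqueDiffOn_Ico t₀ T
  have hS' : Ico t₀ T ⊆ closure (interior (Ico t₀ T)) := by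
    rw [interior_Ico, closure_Ioo ht₀.ne]; exact Ico_subset_Icc_self
  obtain ⟨A₀, hA₀, hΓ⟩ := abs_chrCoef_le_log b hG hfl hK hKV ht₀ hginv hR1
  -- the bound at `t₀` on the compact `K`
  have hinit : ∀ q : ι × ι × ι × ι, ∃ Bq : ℝ, ∀ y ∈ K,
      |pd b q.1 (fun y' ↦ chrCoef (G t₀) b y' q.2.1 q.2.2.1 q.2.2.2) y| ≤ Bq := by
    rintro ⟨p, j, i, m⟩
    have hc : ContinuousOn (fun y ↦ fderiv ℝ (fun y' ↦ chrCoef (G t₀) b y' j i m) y (b p)) K :=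
      ((((hG.isMetricOn t₀ ht₀').contDiffOn_chrCoef b j i m).continuousOn_fderiv_of_isOpen hV
        (by simp)).mono hKV).clm_apply continuousOn_const
    obtain ⟨B, hB⟩ := hK.exists_bound_of_continuousOn hc
    exact ⟨B, fun y hy ↦ by have h := hB y hy; rwa [Real.norm_eq_abs] at h⟩
  choose Bq hBq using hinit
  set B₁ : ℝ := ∑ q, |Bq q| with hB₁
  have hB₁nn : 0 ≤ B₁ := Finset.sum_nonneg fun _ _ ↦ abs_nonneg _
  have hB₁' : ∀ y ∈ K, ∀ p j i m, |pd b p (fun y' ↦ chrCoef (G t₀) b y' j i m) y| ≤ B₁ := by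
    intro y hy p j i m
    refine ((hBq (p, j, i, m) y hy).trans (le_abs_self _)).trans ?_
    exact Finset.single_le_sum (f := fun q ↦ |Bq q|) (fun _ _ ↦ abs_nonneg _) (Finset.mem_univ (p, j, i, m))
  -- the constants
  set c₁ : ℝ := 3 * Fintype.card ι * |Cg| * |C₂| with hc₁
  set c₂ : ℝ := 15 * (Fintype.card ι) ^ 2 * |Cg| * |C₁| * A₀ with hc₂
  have hc₁nn : 0 ≤ c₁ := by positivity
  have hc₂nn : 0 ≤ c₂ := by positivity
  refine ⟨B₁ + c₁ + c₂, by positivity, fun t ht y hy p j i m ↦ ?_⟩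
  obtain ⟨hlog, hlog0⟩ := log_ratio_eq ht
  have hyV : y ∈ V := hKV hy
  -- the function `F(s) = ∂_p Γ^m_{ji}(y, s)` and its time derivative within `[t₀, T)`
  have hjoint : ContDiffOn ℝ ∞ (fun q : E × ℝ ↦ chrCoef (G q.2) b q.1 j i m) (V ×ˢ Ico t₀ T) :=
    hG.contDiffOn_chrCoef_family b j i m
  have hder : ∀ s ∈ Ico t₀ T, HasDerivWithinAt (fun s ↦ pd b p (fun y' ↦ chrCoef (G s) b y' j i m) y)
      (pd b p (fun z ↦ -∑ d, ginv (G s) b z m d * (tcov (G s) b (ric2 (G s) b) z (ocons j (pair i d))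
        + tcov (G s) b (ric2 (G s) b) z (ocons i (pair j d))
        - tcov (G s) b (ric2 (G s) b) z (ocons d (pair j i)))) y) (Ico t₀ T) s := by
    intro s hs
    have h1 := hasDerivWithinAt_pdIter (b := b) hV hS (Φ := fun s y' ↦ chrCoef (G s) b y' j i m) hjoint [p] hyV hs
    have h2 := derivWithin_pdIter_comm (b := b) hV hS hS' [p] (Φ := fun s y' ↦ chrCoef (G s) b y' j i m) hjoint hyV hs
    have heq : EqOn (fun z ↦ derivWithin (fun s' ↦ chrCoef (G s') b z j i m) (Ico t₀ T) s)
        (fun z ↦ -∑ d, ginv (G s) b z m d * (tcov (G s) b (ric2 (G s) b) z (ocons j (pair i d))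
          + tcov (G s) b (ric2 (G s) b) z (ocons i (pair j d))
          - tcov (G s) b (ric2 (G s) b) z (ocons d (pair j i)))) V := fun z hz ↦
      (hG.hasDerivWithinAt_chrCoef_of_flow' b hfl hs hz j i m).derivWithin (hS s hs)
    have h3 := pd_congr (b := b) hV heq p hyV
    simp only [pdIter_cons, pdIter_nil] at h1 h2 h3
    rw [h2, h3] at h1
    exact h1
  -- the bound on the time derivative
  have hbound : ∀ s ∈ Ico t₀ T,
      |pd b p (fun z ↦ -∑ d, ginv (G s) b z m d * (tcov (G s) b (ric2 (G s) b) z (ocons j (pair i d))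
        + tcov (G s) b (ric2 (G s) b) z (ocons i (pair j d))
        - tcov (G s) b (ric2 (G s) b) z (ocons d (pair j i)))) y| ≤
      (c₁ + c₂) * (1 / (T - s)) + c₂ * ((Real.log (T - t₀) - Real.log (T - s)) / (T - s)) := by
    intro s hs
    have hTs : 0 < T - s := sub_pos.2 hs.2
    obtain ⟨hlogs, hlogs0⟩ := log_ratio_eq hs
    have hg₀ : ∀ a c, |ginv (G s) b y a c| ≤ |Cg| / (T - s) := fun a c ↦
      (hginv s hs y hy a c).trans (div_le_div_of_nonneg_right (le_abs_self _) hTs.le)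
    have h := abs_fderiv_chrDot_le b (hG.isMetricOn s hs) hyV hg₀ (hΓ s hs y hy)
      (fun J ↦ (hR1 s hs y hy J).trans (le_abs_self _)) (fun J ↦ (hR2 s hs y hy J).trans (le_abs_self _))
      p j i m
    rw [pd_apply]
    refine h.trans (le_of_eq ?_)
    rw [← hlogs, hc₁, hc₂]
    field_simp
    ring
  -- comparison
  have hBc : ContinuousOn (fun s ↦ (c₁ + c₂) * -Real.log (T - s) +
      c₂ * ((Real.log (T - t₀) - Real.log (T - s)) ^ 2 / 2)) (Ico t₀ T) := by
    have h1 : ContinuousOn (fun s : ℝ ↦ Real.log (T - s)) (Ico t₀ T) :=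
      (continuousOn_const.sub continuousOn_id).log fun s hs ↦ (sub_pos.2 hs.2).ne'
    exact (continuousOn_const.mul h1.neg).add
      (continuousOn_const.mul (((continuousOn_const.sub h1).pow 2).div_const 2))
  have key := abs_le_of_deriv_boundary
    (B' := fun s ↦ (c₁ + c₂) * (1 / (T - s)) + c₂ * ((Real.log (T - t₀) - Real.log (T - s)) / (T - s)))
    hder hBc
    (fun s hs ↦ ((hasDerivWithinAt_log_sub hs.2).const_mul (c₁ + c₂)).add
      ((hasDerivWithinAt_log_sub_sq hs.2).const_mul c₂)) hbound t ht
  -- assemble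
  have hBt : (c₁ + c₂) * -Real.log (T - t) + c₂ * ((Real.log (T - t₀) - Real.log (T - t)) ^ 2 / 2) -
      ((c₁ + c₂) * -Real.log (T - t₀) + c₂ * ((Real.log (T - t₀) - Real.log (T - t₀)) ^ 2 / 2)) =
      (c₁ + c₂) * Real.log ((T - t₀) / (T - t)) + c₂ * (Real.log ((T - t₀) / (T - t)) ^ 2 / 2) := by
    rw [hlog]; ring
  rw [hBt] at key
  have hF0 := hB₁' y hy p j i m
  set ℓ := Real.log ((T - t₀) / (T - t)) with hℓ
  calc _ ≤ |pd b p (fun y' ↦ chrCoef (G t₀) b y' j i m) y| + ((c₁ + c₂) * ℓ + c₂ * (ℓ ^ 2 / 2)) := key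
    _ ≤ B₁ + ((c₁ + c₂) * ℓ + c₂ * (ℓ ^ 2 / 2)) := add_le_add hF0 le_rfl
    _ ≤ (B₁ + c₁ + c₂) * (1 + ℓ) ^ 2 := by
        nlinarith [mul_nonneg hc₂nn hlog0, mul_nonneg hc₁nn hlog0, mul_nonneg hB₁nn hlog0,
          mul_nonneg hB₁nn (sq_nonneg ℓ), mul_nonneg hc₁nn (sq_nonneg ℓ), mul_nonneg hc₂nn (sq_nonneg ℓ)]

/-- **HELPER `helper_abs_pd_chrCoef_le_log_sq`** — the registered form of
`abs_pd_chrCoef_le_log_sq` (squared-logarithmic growth of the first coordinate derivatives of the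
Christoffel symbols of a coordinate Ricci flow with scaled bounds).
[cite: Hamilton1982, §14, Lemma 14.2 ff.] [cite: Topping2006, Prop. 2.3.1] -/
theorem helper_abs_pd_chrCoef_le_log_sq : ∀ {E : Type u} [NormedAddCommGroup E] [NormedSpace ℝ E] [FiniteDimensional ℝ E] [CompleteSpace E] {ι : Type*} [Fintype ι] (b : Module.Basis ι ℝ E) {G : ℝ → E → E →L[ℝ] E →L[ℝ] ℝ} {V K : Set E} {t₀ T : ℝ}, MetricCoord.IsMetricFamilyOn G (Ico t₀ T) V → (∀ s ∈ Ico t₀ T, ∀ y ∈ V, MetricCoord.tDeriv G (Ico t₀ T) s y = (-2 : ℝ) • MetricCoord.ricAt (G s) y) → IsCompact K → K ⊆ V → t₀ < T → ∀ {Cg : ℝ}, (∀ t ∈ Ico t₀ T, ∀ y ∈ K, ∀ a c, |MetricCoord.ginv (G t) b y a c| ≤ Cg / (T - t)) → ∀ {C₁ : ℝ}, (∀ t ∈ Ico t₀ T, ∀ y ∈ K, ∀ J : Fin 1 ⊕ Fin 2 → ι, |MetricCoord.tcovIter (G t) b 1 (MetricCoord.ric2 (G t) b) y J| ≤ C₁)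 → ∀ {C₂ : ℝ}, (∀ t ∈ Ico t₀ T, ∀ y ∈ K, ∀ J : Fin 2 ⊕ Fin 2 → ι, |MetricCoord.tcovIter (G t) b 2 (MetricCoord.ric2 (G t) b) y J| ≤ C₂) → ∃ A₁ : ℝ, 0 ≤ A₁ ∧ ∀ t ∈ Ico t₀ T, ∀ y ∈ K, ∀ p j i m : ι, |MetricCoord.pd b p (fun y' ↦ MetricCoord.chrCoef (G t) b y' j i m) y| ≤ A₁ * (1 + Real.log ((T - t₀) / (T - t))) ^ 2 := by
  intro E _ _ _ _ ι _ b G V K t₀ T hG hfl hK hKV ht₀ Cg hginv C₁ hR1 C₂ hR2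
  exact abs_pd_chrCoef_le_log_sq b hG hfl hK hKV ht₀ hginv hR1 hR2

end LogBounds

end Summit.SmoothPoincare4.SmoothPoincare4.Theorems.MargerinRails

end
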